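import Mathlib
import Summits.Ventures.PercRepro.TriangleCapBand

/-!
# PercRepro — THE CLOSED FORM ON EVERY VERTEX TYPE BY THE DEGREE ARGUMENT ALONE: induction on the sub-diagonal
`r` with the Mantel envelope as the only base (p3, gen 41; part 166)

`closed_form_stability`: for every finite vertex type, every `K₄⁻`-free graph on the cell `m + a² + r = a k`
with `3 ≤ a` and `2a + r ≤ k` has `Σ_v d(v)² + r (k − 1 − r) ≤ m k`. The proof is the degree argument of
parts 158–161 (the max-degree cap `d ≤ k − a`, the convexity bound when every degree is `≥ a`, the deletion of a
vertex of degree `d < a` onto the cell `r + d − a` of the same row at `k − 1` or onto the envelope at `k − 1`),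
organised as a strong induction on `r`: the cell reached by a within-row deletion has `r + d − a ≤ r − 1`, so the
only base is `r = 0`, the Mantel envelope `Σ_v d(v)² ≤ m k` of part 119 (`k ≥ 6`). No row theorem of parts
120–157 is used: the whole closed form §10av rests on the degree argument and the envelope. Axioms: standard.
-/

namespace PercRepro

namespace TriangleCap

namespace C047

open Finset

universe u

variable {V : Type*} [Fintype V] [DecidableEq V]

/-- **THE CLOSED FORM BY STRONG INDUCTION ON `r`, EVERY VERTEX TYPE:** on `n` vertices, `K₄⁻`-free, `3 ≤ a`,
`2a + r ≤ n`, `m + a² + r = a n` ⇒ `Σ_v d(v)² + r (n − 1 − r) ≤ m n`. -/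
theorem closed_form_stability_aux (r : ℕ) :
    ∀ (W : Type u) [Fintype W] [DecidableEq W] (D : SimpleGraph W) [DecidableRel D.Adj], K4mFree D →
      ∀ a, 3 ≤ a → 2 * a + r ≤ Fintype.card W → D.edgeFinset.card + a * a + r = a * Fintype.card W →
      ∑ v, deg D v * deg D v + r * (Fintype.card W - 1 - r) ≤ D.edgeFinset.card * Fintype.card W := by
  refine Nat.strong_induction_on r ?_
  intro r ih W _ _ D _ hK a ha hk hm
  rcases Nat.eq_zero_or_pos r with hr0 | hr1
  · -- the diagonal: the Mantel envelope
    subst hr0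
    simp only [zero_mul, add_zero]
    exact sum_deg_sq_le_of_k4mFree D hK (by omega)
  -- the max-degree cap
  have hcap : ∀ v, deg D v + a ≤ Fintype.card W := fun v =>
    deg_add_le_card_of_dense D hK a ha (by omega)
      (cap_arith a (Fintype.card W) D.edgeFinset.card r (by omega) hk hm) v
  by_cases hdeg : ∀ z, a ≤ deg D z
  · exact band_stability_of_min_degree D a r (by omega) hcap hdeg (by omega) hm
  push Not at hdeg
  obtain ⟨z, hz⟩ := hdeg
  rcases Nat.lt_or_ge (r + deg D z) a with hcross | hwithin
  · exact band_of_low_degree_cross D hK a r hcap (z := z) (by omega) (by omega) (by omega) hm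
  · have hK' := k4mFree_del D hK z
    have hcard' := card_del z
    have hedges' := card_edges_del D z
    have hak : a * Fintype.card W = a * Fintype.card {v : W // v ≠ z} + a := by
      rw [← hcard']
      ring
    have hm' : (del D z).edgeFinset.card + a * a + (r + deg D z - a) = a * Fintype.card {v : W // v ≠ z} := by
      omega
    have hrow := ih (r + deg D z - a) (by omega) {v : W // v ≠ z} (del D z) hK' a ha (by omega) hm'
    exact band_of_low_degree D a r hcap (z := z) (by omega) hwithin (by omega) hm hrow

/-- **THE CLOSED FORM ON EVERY VERTEX TYPE:** `K₄⁻`-free, `3 ≤ a`, `2a + r ≤ k`, `m + a² + r = a k` ⇒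
`Σ_v d(v)² + r (k − 1 − r) ≤ m k` — the degree argument with the envelope as the only base. -/
theorem closed_form_stability (D : SimpleGraph V) [DecidableRel D.Adj] (hK : K4mFree D) (a r : ℕ) (ha : 3 ≤ a)
    (hk : 2 * a + r ≤ Fintype.card V) (hm : D.edgeFinset.card + a * a + r = a * Fintype.card V) :
    ∑ v, deg D v * deg D v + r * (Fintype.card V - 1 - r) ≤ D.edgeFinset.card * Fintype.card V :=
  closed_form_stability_aux r V D hK a ha hk hm

/-- The same in the cherry form: `2·Σ_v C(d(v), 2) + r (k − 1 − r) ≤ m (k − 2)`. -/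
theorem closed_form_cherries (D : SimpleGraph V) [DecidableRel D.Adj] (hK : K4mFree D) (a r : ℕ) (ha : 3 ≤ a)
    (hk : 2 * a + r ≤ Fintype.card V) (hm : D.edgeFinset.card + a * a + r = a * Fintype.card V) :
    2 * cherries D + r * (Fintype.card V - 1 - r) ≤ D.edgeFinset.card * (Fintype.card V - 2) := by
  have h1 := closed_form_stability D hK a r ha hk hm
  have h2 := two_mul_cherries_add D
  have h3 := sum_deg_eq D
  obtain ⟨s, hs⟩ : ∃ s, Fintype.card V = s + 2 := ⟨Fintype.card V - 2, by omega⟩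
  rw [hs] at h1 ⊢
  rw [Nat.add_sub_cancel]
  nlinarith [h1, h2, h3]

end C047

end TriangleCap

end PercRepro
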